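import Literature.MathematicalPhysics.QuantumFieldTheory.Balaban1983to89.BlockAveragingFederbush

/-!
# (0.9) FOR FEDERBUSH'S IMPLICIT AVERAGE AT THE GENERALITY OF PRINT: `G`-VALUEDNESS ON EVERY LOG-CHARTED
# CLOSED SUBGROUP, BY THE NEWTON ITERATION `X_{k+1} = e^{−F(X_k)} X_k`

T. Bałaban, *Renormalization group approach to lattice gauge field theories. I*, Comm. Math. Phys. **109** (1987)
249–301 (`Balaban1987RG1`, "B12"), §0.  The standing assumption on the group, pp. 251–252:

«Field configurations have values in a compact Lie group G. For definitions concerning Lie groups and algebras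
see [71]. We assume that G is semisimple and that it is a Lie subgroup of a group of complex unitary matrices,
for example G ⊂ U(N). (In fact a bigger part of our considerations does not depend on the semisimplicity
assumption.)»

and, p. 252, «Therefore we also consider the complexified group Gᶜ. Elements of this group are defined as matrices
of the form 𝐔 = U′U, where U ∈ G and U′ = exp iA′, A′ ∈ 𝐠ᶜ, 𝐠ᶜ is the complexification of the real Lie algebra 𝐠.»
The axiomatic average, p. 253: «We introduce an axiomatric definition of such an average. It is a Gᶜ-valued function
defined on sets {𝐔_j : j = 1, 2, ..., n}, 𝐔_j ∈ Gᶜ, with sufficiently small diameters.» … «if 𝐔_j ∈ G, then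
M({𝐔_j}) ∈ G also. (0.9)» … «Let us write a definition which is equivalent to the one given by Federbush in [35].
The average of the set {𝐔_j} is the element 𝐔 ∈ Gᶜ such that 𝐔_j are in a small neighborhood of 𝐔, and it
satisfies the equation Σ_{j=1}^{n} (1/i) log 𝐔_j 𝐔⁻¹ = 0. (0.10) This definition has all the properties listed
above, as it was proved by Federbush in [35 (II)].»

## What this file PROVES (nothing printed is asserted; every statement is about the tree's construction)

The module `BlockAveragingFederbush` constructs, for a finite family `W` in a complete normed `ℂ`-algebra with
`‖W_j − 1‖ ≤ 1/100`, THE solution `X = fedSol W` of (0.10) in the form `Σ_j log (W_j X) = 0` (`log` = the series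
(21), `MatrixLog.mlog`) with `‖X − 1‖ ≤ 3/100` — by `Classical.choose` from an existence theorem — and the group
average `fedM δ U = (fedSol (U_j U₀*))* U₀` on matrix families, and it verifies (0.9) for exactly TWO groups:
`G = U(N)` (`fedSol_mem_unitaryGroup`, `fedM_mem_unitaryGroup`) and `G = SU(N)` (`fedSol_mem_specialUnitaryGroup`,
`fedM_mem_specialUnitaryGroup`; sharp radius in `BlockAveragingFederbushRadiusExact`).  Print states (0.9) for an
arbitrary «Lie subgroup of a group of complex unitary matrices».  THIS FILE proves (0.9) for the tree's construction
at that generality, for a READER'S MODEL of «Lie subgroup» stated as data (§1), by making the solution of (0.10)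
CONSTRUCTIVE (§2):

* §1 `LogChart 𝔸` — a closed subset `G ∋ 1` of `𝔸` closed under multiplication, together with a real-linear
  subspace `𝔤` and a radius `ρ > 0` such that `exp 𝔤 ⊆ G` and `log (G ∩ {‖g − 1‖ ≤ ρ}) ⊆ 𝔤` (the exponential
  chart of a matrix Lie group at the identity; Cartan's closed-subgroup theorem, which would PRODUCE `𝔤` and `ρ`
  from a closed subgroup of `GL(N, ℂ)`, is not in Mathlib, so the chart is carried as data and INSTANCED in §2 —
  existence is never assumed).
* §2 INSTANCES (constructed, not assumed): `unitaryLogChart` (`G = U(N)`, `𝔤 = 𝔲(N)` = Mathlib's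
  `skewAdjoint.submodule ℝ`, `ρ = 1/3`; by the tree's `ExpMeanLog.star_mlog_eq_neg` and Mathlib's
  `NormedSpace.exp_mem_unitary_of_mem_skewAdjoint`), `specialUnitaryLogChart` (`G = SU(N)`, `𝔤 = 𝔲(N) ∩ ker tr`,
  `ρ = min(1/3, 3/N)`; by `ExpMeanLog.trace_mlog_eq_zero` and Liouville's formula `det_exp_eq_exp_trace`), and — for
  the complexified group of print's «𝐔_j ∈ Gᶜ» with `G = SU(N)` — `specialLinearLogChart` (`Gᶜ = SL(N, ℂ) = {det = 1}`,
  `𝔤ᶜ = ker tr`, same `ρ`; by `ExpMeanLog.trace_mlog_eq_zero_of_det_eq_one`).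
* §3 THE NEWTON ∕ FEDERBUSH ITERATION `fedIter W : ℕ → 𝔸`, `X₀ = 1`, `X_{k+1} = exp(−F(X_k))·X_k` with
  `F(X) = fed W X = |I|⁻¹ Σ_j log (W_j X)`: for `‖W_j − 1‖ ≤ δ ≤ 1/100` the residuals contract,
  `‖F(X_{k+1})‖ ≤ (1/6)‖F(X_k)‖` (`norm_fed_newton_le`, from the base module's approximate linearity
  `norm_fed_sub_fed_sub_le` and `‖e^A − 1 − A‖ ≤ ‖A‖²`), the iterates stay in the ball `‖X_k − 1‖ ≤ (66/25)δ`
  (`fedIter_inv`), form a Cauchy sequence, and CONVERGE TO `fedSol W` (`tendsto_fedIter`, by the base module's local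
  uniqueness `fedSol_unique`) at the rate `‖X_k − fedSol W‖ ≤ (66/25)δ·6^{−k}` (`norm_fedIter_sub_fedSol_le`) — a
  constructive description of the choice-defined `fedSol` (`fedSol_eq_lim_fedIter`).
* §4 (0.9) ON EVERY LOG-CHARTED `G` (`fedIter_mem`, `fedSol_mem_logChart`): if `W_j ∈ G`, `‖W_j − 1‖ ≤ δ ≤ 1/100` and
  `4δ ≤ ρ`, every iterate lies in `G` (each `W_j X_k ∈ G` is within `4δ ≤ ρ` of `1`, so `log (W_j X_k) ∈ 𝔤`, their
  real average `F(X_k) ∈ 𝔤`, `exp(−F(X_k)) ∈ G`, products stay in `G`), hence so does the limit (`G` closed):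
  `fedSol W ∈ G`.  On matrix families (§4b, `fedM_mem_logChart`): for a log-charted `G` closed under `star` (for
  `G ⊆ U(N)`: a subgroup), every `G`-valued family `U` has `fedM δ U ∈ G` (`δ ≤ 1/100`, `4δ ≤ ρ`; on and off the
  guard).
* §5 COROLLARIES: `fedSol W ∈ U(N)`, `fedM δ U ∈ U(N)` for unitary families and `δ ≤ 1/100` (re-deriving the base
  module's `fedSol_mem_unitaryGroup` ∕ `fedM_mem_unitaryGroup` through the general theorem); `fedSol W ∈ SU(N)`,
  `fedM δ U ∈ SU(N)` for `SU(N)`-families with `δ ≤ 1/100`, `N·δ ≤ 3/4` (`fedSol_mem_specialUnitaryGroup_of_chart`,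
  `fedM_mem_specialUnitaryGroup_of_chart`; the base module has `N·δ ≤ 1/3`, `BlockAveragingFederbushRadiusExact` the
  sharp `δ ≤ 2 sin(π/N)`); `det (fedSol W) = 1` for `SL(N, ℂ)`-families with `δ ≤ 1/100`, `N·δ ≤ 3/4`
  (`det_fedSol_eq_one_of_chart`; cf. `BlockAveragingFederbushRadius.det_fedSol_eq_one_of_det_eq_one` under
  `N·δ ≤ 1/3`); and non-vacuity: the radii `1/100` of `federbushU` and `deltaFed n` of `federbushSU` meet the
  hypotheses.
* §6 (v1.1) INTERSECTIONS, REAL FORMS, COMPLEXIFICATIONS: `LogChart.inf` (the intersection of two log-charted `G`'s is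
  log-charted: `G₁ ∩ G₂`, `𝔤₁ ⊓ 𝔤₂`, `min ρ₁ ρ₂`); the entrywise complex conjugation `conjEntry` commutes with `exp`
  and with the series `log` (`conjEntry_exp`, `conjEntry_mlog` — the coefficients of (21) are real), whence
  `realLogChart` (`{Ā = A}`, `ρ = 1/2`) and the REAL GROUPS `orthogonalLogChart` (`O(N) = U(N) ∩ {Ā = A}`, `𝔬(N)` =
  the real antisymmetric matrices, `ρ = 1/3`) and `specialOrthogonalLogChart` (`SO(N) = SU(N) ∩ {Ā = A}`); the
  transpose of (21) (`hasSum_mlog_transpose`) and `log g⁻¹ = −log g` for `‖g − 1‖ ≤ 1/3` (`mlog_inv`, by the tree's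
  `B7BlockAvgLog.mlog_exp`) give `(log g)ᵀ = −log g` on `gᵀ g = 1` (`transpose_mlog_eq_neg`), whence the
  COMPLEXIFICATIONS `complexOrthogonalLogChart` (`O(N, ℂ) = {gᵀ g = 1}`, the antisymmetric complex matrices,
  `ρ = 1/3`; `exp` side by Mathlib's `Matrix.exp_transpose`) and `specialComplexOrthogonalLogChart`
  (`SO(N, ℂ) = O(N, ℂ) ∩ SL(N, ℂ) = SO(N)ᶜ`, print's `Gᶜ` for `G = SO(N)`), with `O(N) ⊆ O(N, ℂ)`,
  `SO(N) ⊆ SO(N, ℂ)`; the (0.9) corollaries `fedSol W, fedM δ U ∈ O(N)` (`δ ≤ 1/100`), `∈ SO(N)`, `∈ O(N, ℂ)`,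
  `∈ SO(N, ℂ)` and `det (fedM δ U) = 1` on `SL(N, ℂ)` (`δ ≤ 1/100`, `N·δ ≤ 3/4`; the complexified charts are
  `star`-closed, so §4b applies to them too), plus non-vacuity at the constant family.

## What is NOT encoded

* That every closed subgroup of `U(N)` (print's «Lie subgroup») carries a `LogChart` — Cartan's theorem; only the
  instances of §2 and §6 and their intersections (`LogChart.inf`) are constructed.  `Sp(N)` (`J Ā J⁻¹ = A`) is a
  routine further instance left undone here (v1 listed `SO(N)` as undone; §6 of v1.1 constructs it).
* Semisimplicity plays no role in (0.9)–(0.10) and is not modelled (print: «a bigger part of our considerations does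
  not depend on the semisimplicity assumption»).  Compactness enters ONLY as closedness of `G` (the field
  `LogChart.isClosed`, used to pass from the iterates to the limit `fedSol W`): a non-closed «Lie subgroup» (a dense
  winding line in `U(2)`) is outside the model and (0.9) can fail for it (advisory A1 of `GAPS.md` C-pv11g13-1).
* Radii: the numbers `1/100`, `1/6`, `66/25`, `4δ ≤ ρ`, `3/N` are the FILE'S, not print's («sufficiently small
  diameters»); nothing is claimed for `δ > 1/100`, where the tree's `fedSol` is not constructed.
* Nothing here is a statement of print beyond the quoted (0.9): the Newton iteration is the file's device (B12 does
  not specify how (0.10) is solved; Federbush's preprints [35] were not consulted — advisory A2 of C-pv11g13-1).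

v1.1 (2026-08-19): §6 APPENDED after `end FederbushMean` of v1; every DECLARATION of v1 (§§1–5) is byte-identical —
in the v1 text only this header (the §6 bullet, «NOT encoded» bullets 1, 2, 4, this paragraph) and the docstring of
`fedIter` (advisory A3 of `GAPS.md` C-pv11g13-1) changed.

Model conventions: `[cite: Balaban1987RG1, (0.9) p.253]` sits on the verifications of (0.9) for the constructed
average (`fedSol_mem_logChart`, `fedM_mem_logChart` and their instances in §5 and §6), exactly as on the tree's
`fedSol_mem_unitaryGroup` ∕ `fedM_mem_unitaryGroup` which they generalise; everything else is `[folklore]`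
(Banach-algebra calculus: Newton iteration, geometric series, closedness).
-/

noncomputable section

open NormedSpace Metric Set Filter Topology

namespace Literature.MathematicalPhysics.QuantumFieldTheory.Balaban1983to89

open MatrixLog
open Literature.Analysis.Matrix (det_exp_eq_exp_trace)

/-! ## §1 Log-charted closed subgroups (reader's model of «Lie subgroup of a group of complex unitary matrices») -/

section Chart

variable (𝔸 : Type*) [NormedRing 𝔸] [NormedAlgebra ℂ 𝔸]

/-- **A LOG-CHARTED CLOSED SUBGROUP** of a normed `ℂ`-algebra `𝔸`: a closed subset `G ∋ 1` closed under
multiplication, a real-linear subspace `𝔤` («the real Lie algebra 𝐠», p. 252) and a radius `ρ > 0` with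
`exp 𝔤 ⊆ G` and `log g ∈ 𝔤` for every `g ∈ G` with `‖g − 1‖ ≤ ρ` (`log` = the series (21) `MatrixLog.mlog`).  This is
the exponential chart at the identity of a matrix Lie group, carried as DATA (reader's model of print's «Lie
subgroup of a group of complex unitary matrices», pp. 251–252; instances `unitaryLogChart`, `specialUnitaryLogChart`,
`specialLinearLogChart` in §2 — nothing is assumed to exist).  Inverses are not part of the data: (0.9)–(0.10) use
only products, `exp` and `log`. [folklore] -/
structure LogChart where
  /-- the group `G` as a subset of the ambient algebra -/
  carrier : Set 𝔸
  /-- the real Lie algebra `𝔤` -/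
  lie : Submodule ℝ 𝔸
  /-- the radius of the logarithmic chart around `1` -/
  ρ : ℝ
  ρ_pos : 0 < ρ
  one_mem : (1 : 𝔸) ∈ carrier
  mul_mem : ∀ ⦃a b : 𝔸⦄, a ∈ carrier → b ∈ carrier → a * b ∈ carrier
  isClosed : IsClosed carrier
  exp_mem : ∀ ⦃A : 𝔸⦄, A ∈ lie → exp A ∈ carrier
  mlog_mem : ∀ ⦃g : 𝔸⦄, g ∈ carrier → ‖g - 1‖ ≤ ρ → mlog g ∈ lie

end Chart

/-! ## §2 Instances: `U(N)`, `SU(N)`, and the complexification `SL(N, ℂ)` of `SU(N)` (constructed, not assumed) -/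

section Instances

open scoped Matrix.Norms.L2Operator
open ExpMeanLog (star_mlog_eq_neg trace_mlog_eq_zero trace_mlog_eq_zero_of_det_eq_one)

variable {n : Type*} [Fintype n] [DecidableEq n]

/-- **`U(N)` IS LOG-CHARTED**: `G = U(N)`, `𝔤 = 𝔲(N) = {A : A* = −A}` (Mathlib's `skewAdjoint.submodule ℝ`),
`ρ = 1/3` — `exp` of a skew-adjoint matrix is unitary (Mathlib `NormedSpace.exp_mem_unitary_of_mem_skewAdjoint`) and
`log` of a unitary within `1/3` of `1` is skew-adjoint (the tree's `ExpMeanLog.star_mlog_eq_neg`). [folklore] -/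
def unitaryLogChart (n : Type*) [Fintype n] [DecidableEq n] : LogChart (Matrix n n ℂ) where
  carrier := Matrix.unitaryGroup n ℂ
  lie := skewAdjoint.submodule ℝ (Matrix n n ℂ)
  ρ := 1 / 3
  ρ_pos := by norm_num
  one_mem := Submonoid.one_mem _
  mul_mem := fun _ _ ha hb => Submonoid.mul_mem _ ha hb
  isClosed := isClosed_unitary
  exp_mem := fun A (hA : A ∈ skewAdjoint (Matrix n n ℂ)) => by
    letI : NormedAlgebra ℚ (Matrix n n ℂ) := NormedAlgebra.restrictScalars ℚ ℂ _
    exact exp_mem_unitary_of_mem_skewAdjoint hA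
  mlog_mem := fun _ hg hs => show _ ∈ skewAdjoint (Matrix n n ℂ) from skewAdjoint.mem_iff.2 (star_mlog_eq_neg hg hs)

/-- The carrier of the `U(N)` chart is `U(N)`. [folklore] -/
@[simp] theorem unitaryLogChart_carrier :
    (unitaryLogChart n).carrier = Matrix.unitaryGroup n ℂ := rfl

/-- The Lie algebra of the `U(N)` chart is `𝔲(N) = {A : A* = −A}`. [folklore] -/
@[simp] theorem mem_unitaryLogChart_lie {A : Matrix n n ℂ} :
    A ∈ (unitaryLogChart n).lie ↔ star A = -A := skewAdjoint.mem_iff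

/-- The radius of the `U(N)` chart is `1/3`. [folklore] -/
@[simp] theorem unitaryLogChart_ρ : (unitaryLogChart n).ρ = 1 / 3 := rfl

variable [Nonempty n]

/-- `N·‖X − 1‖ < π` from `‖X − 1‖ ≤ min(1/3, 3/N)`. [folklore] -/
theorem card_mul_norm_sub_one_lt_pi {X : Matrix n n ℂ} (hs : ‖X - 1‖ ≤ min (1 / 3) (3 / (Fintype.card n : ℝ))) :
    (Fintype.card n : ℝ) * ‖X - 1‖ < Real.pi := by
  have hN : (0 : ℝ) < Fintype.card n := Nat.cast_pos.mpr Fintype.card_pos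
  have h3 : ‖X - 1‖ ≤ 3 / (Fintype.card n : ℝ) := hs.trans (min_le_right _ _)
  have h : (Fintype.card n : ℝ) * ‖X - 1‖ ≤ 3 := by
    calc (Fintype.card n : ℝ) * ‖X - 1‖ ≤ (Fintype.card n : ℝ) * (3 / (Fintype.card n : ℝ)) := by gcongr
      _ = 3 := mul_div_cancel₀ _ hN.ne'
  linarith [Real.pi_gt_three]

/-- **`SU(N)` IS LOG-CHARTED**: `G = SU(N)`, `𝔤 = 𝔰𝔲(N) = {A* = −A} ∩ ker tr`, `ρ = min(1/3, 3/N)` — `det e^A = e^{tr A}`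
(Liouville, the tree's `det_exp_eq_exp_trace`) and `tr log W = 0` for `W ∈ SU(N)` with `‖W − 1‖ ≤ 1/3`,
`N‖W − 1‖ < π` (the tree's `ExpMeanLog.trace_mlog_eq_zero`). [folklore] -/
def specialUnitaryLogChart (n : Type*) [Fintype n] [DecidableEq n] [Nonempty n] : LogChart (Matrix n n ℂ) where
  carrier := Matrix.specialUnitaryGroup n ℂ
  lie := skewAdjoint.submodule ℝ (Matrix n n ℂ) ⊓ (LinearMap.ker (Matrix.traceLinearMap n ℂ ℂ)).restrictScalars ℝ
  ρ := min (1 / 3) (3 / (Fintype.card n : ℝ))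
  ρ_pos := lt_min (by norm_num) (div_pos (by norm_num) (Nat.cast_pos.mpr Fintype.card_pos))
  one_mem := Submonoid.one_mem _
  mul_mem := fun _ _ ha hb => Submonoid.mul_mem _ ha hb
  isClosed := by
    have h : (Matrix.specialUnitaryGroup n ℂ : Set (Matrix n n ℂ))
        = (Matrix.unitaryGroup n ℂ : Set (Matrix n n ℂ)) ∩ (fun A : Matrix n n ℂ => A.det) ⁻¹' {1} := by
      ext A
      simp [Matrix.mem_specialUnitaryGroup_iff]
    rw [h]
    exact isClosed_unitary.inter (isClosed_singleton.preimage (continuous_id.matrix_det))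
  exp_mem := fun A hA => by
    letI : NormedAlgebra ℚ (Matrix n n ℂ) := NormedAlgebra.restrictScalars ℚ ℂ _
    obtain ⟨hskew, htr⟩ := Submodule.mem_inf.1 hA
    rw [Submodule.restrictScalars_mem, LinearMap.mem_ker, Matrix.traceLinearMap_apply] at htr
    refine Matrix.mem_specialUnitaryGroup_iff.2 ⟨exp_mem_unitary_of_mem_skewAdjoint hskew, ?_⟩
    rw [det_exp_eq_exp_trace, htr, exp_zero]
  mlog_mem := fun _ hg hs => by
    refine Submodule.mem_inf.2 ⟨?_, ?_⟩
    · exact skewAdjoint.mem_iff.2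
        (star_mlog_eq_neg (Matrix.mem_specialUnitaryGroup_iff.1 hg).1 (hs.trans (min_le_left _ _)))
    · rw [Submodule.restrictScalars_mem, LinearMap.mem_ker, Matrix.traceLinearMap_apply]
      exact trace_mlog_eq_zero hg (hs.trans (min_le_left _ _)) (card_mul_norm_sub_one_lt_pi hs)

/-- The carrier of the `SU(N)` chart is `SU(N)`. [folklore] -/
@[simp] theorem specialUnitaryLogChart_carrier :
    (specialUnitaryLogChart n).carrier = Matrix.specialUnitaryGroup n ℂ := rfl

/-- The Lie algebra of the `SU(N)` chart is `𝔰𝔲(N) = {A : A* = −A, tr A = 0}`. [folklore] -/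
@[simp] theorem mem_specialUnitaryLogChart_lie {A : Matrix n n ℂ} :
    A ∈ (specialUnitaryLogChart n).lie ↔ star A = -A ∧ A.trace = 0 := by
  show A ∈ skewAdjoint.submodule ℝ (Matrix n n ℂ) ⊓ _ ↔ _
  rw [Submodule.mem_inf, Submodule.restrictScalars_mem, LinearMap.mem_ker, Matrix.traceLinearMap_apply]
  exact and_congr_left' skewAdjoint.mem_iff

/-- The radius of the `SU(N)` chart is `min(1/3, 3/N)`. [folklore] -/
@[simp] theorem specialUnitaryLogChart_ρ :
    (specialUnitaryLogChart n).ρ = min (1 / 3) (3 / (Fintype.card n : ℝ)) := rfl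

/-- **`SL(N, ℂ)` — THE COMPLEXIFICATION `Gᶜ` OF `SU(N)` — IS LOG-CHARTED**: `Gᶜ = {det = 1}`, `𝔤ᶜ = 𝔰𝔩(N, ℂ) = ker tr`,
`ρ = min(1/3, 3/N)` (Liouville's formula and the tree's `ExpMeanLog.trace_mlog_eq_zero_of_det_eq_one`).  Print's
operation is «a Gᶜ-valued function defined on sets {𝐔_j …}, 𝐔_j ∈ Gᶜ» (p. 253). [folklore] -/
def specialLinearLogChart (n : Type*) [Fintype n] [DecidableEq n] [Nonempty n] : LogChart (Matrix n n ℂ) where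
  carrier := {A | A.det = 1}
  lie := (LinearMap.ker (Matrix.traceLinearMap n ℂ ℂ)).restrictScalars ℝ
  ρ := min (1 / 3) (3 / (Fintype.card n : ℝ))
  ρ_pos := lt_min (by norm_num) (div_pos (by norm_num) (Nat.cast_pos.mpr Fintype.card_pos))
  one_mem := by simp
  mul_mem := fun a b (ha : a.det = 1) (hb : b.det = 1) => by
    show (a * b).det = 1
    rw [Matrix.det_mul, ha, hb, mul_one]
  isClosed := isClosed_singleton.preimage (continuous_id.matrix_det)
  exp_mem := fun A hA => by
    letI : NormedAlgebra ℚ (Matrix n n ℂ) := NormedAlgebra.restrictScalars ℚ ℂ _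
    rw [Submodule.restrictScalars_mem, LinearMap.mem_ker, Matrix.traceLinearMap_apply] at hA
    show (exp A).det = 1
    rw [det_exp_eq_exp_trace, hA, exp_zero]
  mlog_mem := fun _ hg hs => by
    rw [Submodule.restrictScalars_mem, LinearMap.mem_ker, Matrix.traceLinearMap_apply]
    exact trace_mlog_eq_zero_of_det_eq_one hg (hs.trans (min_le_left _ _)) (card_mul_norm_sub_one_lt_pi hs)

/-- The carrier of the `SL(N, ℂ)` chart is `{det = 1}`. [folklore] -/
@[simp] theorem mem_specialLinearLogChart_carrier {A : Matrix n n ℂ} :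
    A ∈ (specialLinearLogChart n).carrier ↔ A.det = 1 := Iff.rfl

/-- The Lie algebra of the `SL(N, ℂ)` chart is `𝔰𝔩(N, ℂ) = {A : tr A = 0}`. [folklore] -/
@[simp] theorem mem_specialLinearLogChart_lie {A : Matrix n n ℂ} :
    A ∈ (specialLinearLogChart n).lie ↔ A.trace = 0 := by
  show A ∈ (LinearMap.ker (Matrix.traceLinearMap n ℂ ℂ)).restrictScalars ℝ ↔ _
  rw [Submodule.restrictScalars_mem, LinearMap.mem_ker, Matrix.traceLinearMap_apply]

/-- The radius of the `SL(N, ℂ)` chart is `min(1/3, 3/N)`. [folklore] -/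
@[simp] theorem specialLinearLogChart_ρ :
    (specialLinearLogChart n).ρ = min (1 / 3) (3 / (Fintype.card n : ℝ)) := rfl

end Instances

namespace FederbushMean

open ExpMeanLog

/-! ## §3 The Newton ∕ Federbush iteration for (0.10) and its convergence to `fedSol` -/

section Newton

variable {𝔸 : Type*} [NormedRing 𝔸] [NormedAlgebra ℂ 𝔸] [CompleteSpace 𝔸]
variable {ι : Type*} [Fintype ι]

/-- `‖e^{−F} − 1‖ ≤ (51/50)‖F‖` for `‖F‖ ≤ 1/50` (from `‖e^A − 1 − A‖ ≤ ‖A‖²`). [folklore] -/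
theorem norm_exp_neg_sub_one_le {F : 𝔸} (hF : ‖F‖ ≤ 1 / 50) : ‖exp (-F) - 1‖ ≤ 51 / 50 * ‖F‖ := by
  have h1 : ‖exp (-F) - 1 - (-F)‖ ≤ ‖-F‖ ^ 2 :=
    OneLinkLaplace.norm_exp_sub_one_sub_le_sq (by rw [norm_neg]; linarith)
  rw [norm_neg] at h1
  have h2 : ‖exp (-F) - 1‖ ≤ ‖exp (-F) - 1 - (-F)‖ + ‖-F‖ := by
    have := norm_add_le (exp (-F) - 1 - (-F)) (-F)
    rwa [sub_add_cancel] at this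
  rw [norm_neg] at h2
  have h3 : ‖F‖ ^ 2 ≤ 1 / 50 * ‖F‖ := by
    rw [sq]; exact mul_le_mul_of_nonneg_right hF (norm_nonneg _)
  linarith

/-- One Newton step `X ↦ e^{−F} X` moves by at most `(11/10)‖F‖` (`‖F‖ ≤ 1/50`, `‖X − 1‖ ≤ 1/20`). [folklore] -/
theorem norm_newton_step_le {F X : 𝔸} (hF : ‖F‖ ≤ 1 / 50) (hX : ‖X - 1‖ ≤ 1 / 20) :
    ‖exp (-F) * X - X‖ ≤ 11 / 10 * ‖F‖ := by
  have h : exp (-F) * X - X = (exp (-F) - 1) * X := by noncomm_ring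
  rw [h]
  calc ‖(exp (-F) - 1) * X‖ ≤ ‖exp (-F) - 1‖ * (1 / 20 + 1) := norm_sub_mul_le _ _ hX
    _ ≤ 51 / 50 * ‖F‖ * (1 / 20 + 1) := by gcongr; exact norm_exp_neg_sub_one_le hF
    _ ≤ 11 / 10 * ‖F‖ := by nlinarith [norm_nonneg F]

/-- **THE RESIDUAL CONTRACTS BY `1/6` PER NEWTON STEP.**  For a family with `‖W_j − 1‖ ≤ 1/100`, a point `X` with
`‖X − 1‖ ≤ 1/20`, residual `F = fed W X` of norm `≤ 1/50`, and `X' = e^{−F} X` with `‖X' − 1‖ ≤ 1/20`: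
`‖fed W X'‖ ≤ ‖F‖/6`.  Indeed `fed W X' = [fed W X' − fed W X − (X' − X)] + [e^{−F} − 1 + F] + (e^{−F} − 1)(X − 1)`,
bounded by `(2/25)(11/10)‖F‖ + ‖F‖² + (51/50)(1/20)‖F‖ ≤ 0.159‖F‖` (approximate linearity `norm_fed_sub_fed_sub_le` of
the base module). [folklore] -/
theorem norm_fed_newton_le [Nonempty ι] {W : ι → 𝔸} (hW : ∀ j, ‖W j - 1‖ ≤ 1 / 100) {X : 𝔸}
    (hX : ‖X - 1‖ ≤ 1 / 20) (hF : ‖fed W X‖ ≤ 1 / 50) (hX' : ‖exp (-fed W X) * X - 1‖ ≤ 1 / 20) :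
    ‖fed W (exp (-fed W X) * X)‖ ≤ 1 / 6 * ‖fed W X‖ := by
  set F := fed W X with hF_def
  have hlin : ‖fed W (exp (-F) * X) - F - (exp (-F) * X - X)‖ ≤ 2 / 25 * ‖exp (-F) * X - X‖ := by
    have h := norm_fed_sub_fed_sub_le (R := 1 / 20) hW (by norm_num) hX' hX
    exact h.trans (mul_le_mul_of_nonneg_right (by norm_num) (norm_nonneg _))
  have hstep : ‖exp (-F) * X - X‖ ≤ 11 / 10 * ‖F‖ := norm_newton_step_le hF hX
  have hE1 : ‖exp (-F) - 1 - (-F)‖ ≤ ‖F‖ ^ 2 := by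
    have := OneLinkLaplace.norm_exp_sub_one_sub_le_sq (X := -F) (by rw [norm_neg]; linarith)
    rwa [norm_neg] at this
  have hE2 : ‖(exp (-F) - 1) * (X - 1)‖ ≤ 51 / 50 * ‖F‖ * (1 / 20) :=
    (norm_mul_le _ _).trans (mul_le_mul (norm_exp_neg_sub_one_le hF) hX (norm_nonneg _) (by positivity))
  have hsq : ‖F‖ ^ 2 ≤ 1 / 50 * ‖F‖ := by
    rw [sq]; exact mul_le_mul_of_nonneg_right hF (norm_nonneg _)
  have hdecomp : fed W (exp (-F) * X)
      = (fed W (exp (-F) * X) - F - (exp (-F) * X - X)) + ((exp (-F) - 1 - (-F)) + (exp (-F) - 1) * (X - 1)) := by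
    noncomm_ring
  calc ‖fed W (exp (-F) * X)‖
      = ‖(fed W (exp (-F) * X) - F - (exp (-F) * X - X)) + ((exp (-F) - 1 - (-F)) + (exp (-F) - 1) * (X - 1))‖ := by
        rw [← hdecomp]
    _ ≤ ‖fed W (exp (-F) * X) - F - (exp (-F) * X - X)‖ + (‖exp (-F) - 1 - (-F)‖ + ‖(exp (-F) - 1) * (X - 1)‖) :=
        norm_add_le_of_le le_rfl (norm_add_le _ _)
    _ ≤ 2 / 25 * (11 / 10 * ‖F‖) + (1 / 50 * ‖F‖ + 51 / 50 * ‖F‖ * (1 / 20)) := by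
        gcongr
        · exact hlin.trans (by gcongr)
        · exact hE1.trans hsq
    _ ≤ 1 / 6 * ‖F‖ := by nlinarith [norm_nonneg F]

/-- **THE NEWTON ∕ FEDERBUSH ITERATION for (0.10)**: `X₀ = 1`, `X_{k+1} = exp(−fed W X_k) · X_k`, where
`fed W X = |I|⁻¹ Σ_j log (W_j X)` is the left side of (0.10) (base module).  Each step multiplies on the left by the
exponential of minus the current residual (for a commuting family the first step `X₁ = exp(−|I|⁻¹ Σ_j log W_j)`
already solves (0.10): it is the INVERSE of the abelian exp-mean-log mean of the `W_j` — in the base module's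
convention the solution `X` of `Σ_j log (W_j X) = 0` is the inverse of the average, cf. `fedM δ U = (fedSol …)* U₀`).
[folklore] -/
def fedIter (W : ι → 𝔸) : ℕ → 𝔸
  | 0 => 1
  | k + 1 => exp (-fed W (fedIter W k)) * fedIter W k

omit [CompleteSpace 𝔸] in
/-- The iteration starts at `X₀ = 1`. [folklore] -/
@[simp] theorem fedIter_zero (W : ι → 𝔸) : fedIter W 0 = 1 := rfl

omit [CompleteSpace 𝔸] in
/-- The recursion step of `fedIter`. [folklore] -/
theorem fedIter_succ (W : ι → 𝔸) (k : ℕ) :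
    fedIter W (k + 1) = exp (-fed W (fedIter W k)) * fedIter W k := rfl

variable [Nonempty ι]

/-- **THE NEWTON INVARIANT.**  For `‖W_j − 1‖ ≤ δ ≤ 1/100`: the `k`-th residual has norm `≤ 2δ·6^{−k}` and the
`k`-th iterate satisfies `‖X_k − 1‖ ≤ (66/25)δ(1 − 6^{−k})` (exact telescoping of the step bound
`‖X_{k+1} − X_k‖ ≤ (11/10)‖F_k‖`). [folklore] -/
theorem fedIter_inv {δ : ℝ} (hδ : δ ≤ 1 / 100) {W : ι → 𝔸} (hW : ∀ j, ‖W j - 1‖ ≤ δ) (k : ℕ) :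
    ‖fed W (fedIter W k)‖ ≤ 2 * δ * (1 / 6) ^ k ∧
      ‖fedIter W k - 1‖ ≤ 66 / 25 * δ * (1 - (1 / 6) ^ k) := by
  have hδ0 : 0 ≤ δ := (norm_nonneg _).trans (hW (Classical.arbitrary ι))
  have hW' : ∀ j, ‖W j - 1‖ ≤ 1 / 100 := fun j => (hW j).trans hδ
  induction k with
  | zero =>
    refine ⟨?_, by simp⟩
    simpa using norm_fed_one_le (hδ.trans (by norm_num)) hW
  | succ k ih =>
    obtain ⟨hF, hX⟩ := ih
    have hpow_le : ((1 : ℝ) / 6) ^ k ≤ 1 := pow_le_one₀ (by norm_num) (by norm_num)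
    have hpow_nn : (0 : ℝ) ≤ (1 / 6) ^ k := by positivity
    have h2δ : 2 * δ * (1 / 6 : ℝ) ^ k ≤ 2 * δ := by
      simpa using mul_le_mul_of_nonneg_left hpow_le (by positivity : (0 : ℝ) ≤ 2 * δ)
    have h66 : 66 / 25 * δ * (1 - (1 / 6 : ℝ) ^ k) ≤ 66 / 25 * δ := by
      have : 66 / 25 * δ * (1 - (1 / 6 : ℝ) ^ k) ≤ 66 / 25 * δ * 1 :=
        mul_le_mul_of_nonneg_left (by linarith) (by positivity)
      simpa using this
    have hF' : ‖fed W (fedIter W k)‖ ≤ 1 / 50 := hF.trans (by linarith)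
    have hXR : ‖fedIter W k - 1‖ ≤ 1 / 20 := hX.trans (by linarith)
    have hstep : ‖exp (-fed W (fedIter W k)) * fedIter W k - fedIter W k‖ ≤ 11 / 10 * ‖fed W (fedIter W k)‖ :=
      norm_newton_step_le hF' hXR
    have hX1 : ‖fedIter W (k + 1) - 1‖ ≤ 66 / 25 * δ * (1 - (1 / 6) ^ (k + 1)) := by
      rw [fedIter_succ]
      have hsplit : exp (-fed W (fedIter W k)) * fedIter W k - 1
          = (exp (-fed W (fedIter W k)) * fedIter W k - fedIter W k) + (fedIter W k - 1) := by abel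
      rw [hsplit]
      refine (norm_add_le _ _).trans ?_
      calc ‖exp (-fed W (fedIter W k)) * fedIter W k - fedIter W k‖ + ‖fedIter W k - 1‖
          ≤ 11 / 10 * (2 * δ * (1 / 6) ^ k) + 66 / 25 * δ * (1 - (1 / 6) ^ k) :=
            add_le_add (hstep.trans (by gcongr)) hX
        _ = 66 / 25 * δ * (1 - (1 / 6) ^ (k + 1)) := by ring
    refine ⟨?_, hX1⟩
    have hX1R : ‖fedIter W (k + 1) - 1‖ ≤ 1 / 20 := by
      refine hX1.trans ?_
      have : 66 / 25 * δ * (1 - (1 / 6 : ℝ) ^ (k + 1)) ≤ 66 / 25 * δ * 1 :=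
        mul_le_mul_of_nonneg_left (by linarith [pow_nonneg (by norm_num : (0 : ℝ) ≤ 1 / 6) (k + 1)])
          (by positivity)
      linarith
    rw [fedIter_succ] at hX1R ⊢
    calc ‖fed W (exp (-fed W (fedIter W k)) * fedIter W k)‖ ≤ 1 / 6 * ‖fed W (fedIter W k)‖ :=
          norm_fed_newton_le hW' hXR hF' hX1R
      _ ≤ 1 / 6 * (2 * δ * (1 / 6) ^ k) := by gcongr
      _ = 2 * δ * (1 / 6) ^ (k + 1) := by ring

/-- The iterates stay in the ball `‖X_k − 1‖ ≤ (66/25)δ`. [folklore] -/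
theorem norm_fedIter_sub_one_le {δ : ℝ} (hδ : δ ≤ 1 / 100) {W : ι → 𝔸} (hW : ∀ j, ‖W j - 1‖ ≤ δ) (k : ℕ) :
    ‖fedIter W k - 1‖ ≤ 66 / 25 * δ := by
  have hδ0 : 0 ≤ δ := (norm_nonneg _).trans (hW (Classical.arbitrary ι))
  refine ((fedIter_inv hδ hW k).2).trans ?_
  have : 66 / 25 * δ * (1 - (1 / 6 : ℝ) ^ k) ≤ 66 / 25 * δ * 1 :=
    mul_le_mul_of_nonneg_left (by linarith [pow_nonneg (by norm_num : (0 : ℝ) ≤ 1 / 6) k]) (by positivity)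
  linarith

/-- Along the iteration every product `W_j X_k` is within `4δ` of `1`. [folklore] -/
theorem norm_mul_fedIter_sub_one_le {δ : ℝ} (hδ : δ ≤ 1 / 100) {W : ι → 𝔸} (hW : ∀ j, ‖W j - 1‖ ≤ δ)
    (j : ι) (k : ℕ) : ‖W j * fedIter W k - 1‖ ≤ 4 * δ := by
  have hδ0 : 0 ≤ δ := (norm_nonneg _).trans (hW (Classical.arbitrary ι))
  have h := norm_mul_sub_one_le (hW j) (norm_fedIter_sub_one_le hδ hW k)
  have hprod : 0 ≤ δ * (9 / 25 - 66 / 25 * δ) := mul_nonneg hδ0 (by linarith)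
  nlinarith

/-- Consecutive iterates: `‖X_{k+1} − X_k‖ ≤ (11/5)δ·6^{−k}`. [folklore] -/
theorem dist_fedIter_succ_le {δ : ℝ} (hδ : δ ≤ 1 / 100) {W : ι → 𝔸} (hW : ∀ j, ‖W j - 1‖ ≤ δ) (k : ℕ) :
    dist (fedIter W k) (fedIter W (k + 1)) ≤ 11 / 5 * δ * (1 / 6) ^ k := by
  have hδ0 : 0 ≤ δ := (norm_nonneg _).trans (hW (Classical.arbitrary ι))
  obtain ⟨hF, hX⟩ := fedIter_inv hδ hW k
  have hpow_le : ((1 : ℝ) / 6) ^ k ≤ 1 := pow_le_one₀ (by norm_num) (by norm_num)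
  have h2δ : 2 * δ * (1 / 6 : ℝ) ^ k ≤ 2 * δ := by
    simpa using mul_le_mul_of_nonneg_left hpow_le (by positivity : (0 : ℝ) ≤ 2 * δ)
  have hF' : ‖fed W (fedIter W k)‖ ≤ 1 / 50 := hF.trans (by linarith)
  have hXR : ‖fedIter W k - 1‖ ≤ 1 / 20 := (norm_fedIter_sub_one_le hδ hW k).trans (by linarith)
  rw [dist_eq_norm, norm_sub_rev, fedIter_succ]
  calc ‖exp (-fed W (fedIter W k)) * fedIter W k - fedIter W k‖ ≤ 11 / 10 * ‖fed W (fedIter W k)‖ :=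
        norm_newton_step_le hF' hXR
    _ ≤ 11 / 10 * (2 * δ * (1 / 6) ^ k) := by gcongr
    _ = 11 / 5 * δ * (1 / 6) ^ k := by ring

/-- The Newton iterates form a Cauchy sequence. [folklore] -/
theorem cauchySeq_fedIter {δ : ℝ} (hδ : δ ≤ 1 / 100) {W : ι → 𝔸} (hW : ∀ j, ‖W j - 1‖ ≤ δ) :
    CauchySeq (fedIter W) :=
  cauchySeq_of_le_geometric (1 / 6 : ℝ) (11 / 5 * δ) (by norm_num) (dist_fedIter_succ_le hδ hW)

omit [Nonempty ι] in
/-- `fed W` is continuous at every `Y` with all `‖W_j Y − 1‖ < 1` (each `log (W_j ·)` is analytic there). [folklore] -/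
theorem continuousAt_fed {W : ι → 𝔸} {Y : 𝔸} (h : ∀ j, ‖W j * Y - 1‖ < 1) : ContinuousAt (fed W) Y := by
  have hj : ∀ j, ContinuousAt (fun X => mlog (W j * X)) Y := fun j =>
    (MatrixLog.analyticAt_mlog (h j)).continuousAt.comp' (continuousAt_const.mul continuousAt_id)
  have hsum : ContinuousAt (fun X => ∑ j, mlog (W j * X)) Y :=
    tendsto_finsetSum _ fun j _ => hj j
  have : fed W = fun X => (Fintype.card ι : ℂ)⁻¹ • ∑ j, mlog (W j * X) := by
    funext X; exact fed_def W X
  rw [this]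
  exact hsum.const_smul _

/-- The residuals along the iteration tend to `0`. [folklore] -/
theorem tendsto_fed_fedIter {δ : ℝ} (hδ : δ ≤ 1 / 100) {W : ι → 𝔸} (hW : ∀ j, ‖W j - 1‖ ≤ δ) :
    Tendsto (fun k => fed W (fedIter W k)) atTop (𝓝 0) := by
  refine squeeze_zero_norm (fun k => (fedIter_inv hδ hW k).1) ?_
  have h : Tendsto (fun k : ℕ => 2 * δ * (1 / 6 : ℝ) ^ k) atTop (𝓝 (2 * δ * 0)) :=
    (tendsto_pow_atTop_nhds_zero_of_lt_one (by norm_num) (by norm_num)).const_mul _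
  simpa using h

/-- **THE NEWTON ITERATION CONVERGES TO THE BASE MODULE'S SOLUTION OF (0.10)**: for `‖W_j − 1‖ ≤ δ ≤ 1/100`,
`fedIter W k → fedSol W`.  (The limit `Y` has `‖Y − 1‖ ≤ (66/25)δ ≤ 2/25` and `fed W Y = 0` by continuity, so
`Y = fedSol W` by the local uniqueness `fedSol_unique`.)  This makes the `Classical.choose`-defined `fedSol`
constructive. [folklore] -/
theorem tendsto_fedIter {δ : ℝ} (hδ : δ ≤ 1 / 100) {W : ι → 𝔸} (hW : ∀ j, ‖W j - 1‖ ≤ δ) :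
    Tendsto (fedIter W) atTop (𝓝 (fedSol W)) := by
  have hδ0 : 0 ≤ δ := (norm_nonneg _).trans (hW (Classical.arbitrary ι))
  have hW' : ∀ j, ‖W j - 1‖ ≤ 1 / 100 := fun j => (hW j).trans hδ
  obtain ⟨Y, hY⟩ := cauchySeq_tendsto_of_complete (cauchySeq_fedIter hδ hW)
  have hY1 : ‖Y - 1‖ ≤ 66 / 25 * δ :=
    le_of_tendsto ((hY.sub_const 1).norm) (Eventually.of_forall (norm_fedIter_sub_one_le hδ hW))
  have hWY : ∀ j, ‖W j * Y - 1‖ < 1 := fun j =>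
    (norm_mul_sub_one_le (hW j) hY1).trans_lt (by nlinarith)
  have hcont : Tendsto (fun k => fed W (fedIter W k)) atTop (𝓝 (fed W Y)) :=
    (continuousAt_fed hWY).tendsto.comp hY
  have hfY : fed W Y = 0 := tendsto_nhds_unique hcont (tendsto_fed_fedIter hδ hW)
  have hYsol : Y = fedSol W := fedSol_unique hW' (hY1.trans (by linarith)) hfY
  rwa [hYsol] at hY

/-- **RATE**: `‖X_k − fedSol W‖ ≤ (66/25)δ·6^{−k}`. [folklore] -/
theorem norm_fedIter_sub_fedSol_le {δ : ℝ} (hδ : δ ≤ 1 / 100) {W : ι → 𝔸} (hW : ∀ j, ‖W j - 1‖ ≤ δ)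
    (k : ℕ) : ‖fedIter W k - fedSol W‖ ≤ 66 / 25 * δ * (1 / 6) ^ k := by
  have h := dist_le_of_le_geometric_of_tendsto (1 / 6 : ℝ) (11 / 5 * δ) (by norm_num)
    (dist_fedIter_succ_le hδ hW) (tendsto_fedIter hδ hW) k
  rw [dist_eq_norm] at h
  refine h.trans (le_of_eq ?_)
  ring

/-- **`fedSol W` IS THE LIMIT OF THE NEWTON ITERATION** (uniqueness of limits). [folklore] -/
theorem fedSol_eq_lim_fedIter {δ : ℝ} (hδ : δ ≤ 1 / 100) {W : ι → 𝔸} (hW : ∀ j, ‖W j - 1‖ ≤ δ) :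
    fedSol W = limUnder atTop (fedIter W) :=
  ((tendsto_fedIter hδ hW).limUnder_eq).symm

/-! ## §4 (0.9) on every log-charted closed subgroup -/

/-- **EVERY NEWTON ITERATE LIES IN `G`.**  If `W_j ∈ G`, `‖W_j − 1‖ ≤ δ ≤ 1/100` and `4δ ≤ ρ`: `X_k ∈ G` for all
`k` — by induction, `W_j X_k ∈ G` with `‖W_j X_k − 1‖ ≤ 4δ ≤ ρ`, so `log (W_j X_k) ∈ 𝔤`, the real average
`fed W X_k ∈ 𝔤`, `exp(−fed W X_k) ∈ G`, and `X_{k+1} = exp(−fed W X_k) X_k ∈ G`. [folklore] -/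
theorem fedIter_mem (G : LogChart 𝔸) {δ : ℝ} (hδ : δ ≤ 1 / 100) (hρ : 4 * δ ≤ G.ρ) {W : ι → 𝔸}
    (hW : ∀ j, ‖W j - 1‖ ≤ δ) (hWG : ∀ j, W j ∈ G.carrier) (k : ℕ) : fedIter W k ∈ G.carrier := by
  induction k with
  | zero => exact G.one_mem
  | succ k ih =>
    rw [fedIter_succ]
    refine G.mul_mem (G.exp_mem (G.lie.neg_mem ?_)) ih
    have hsum : ∑ j, mlog (W j * fedIter W k) ∈ G.lie :=
      Submodule.sum_mem _ fun j _ =>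
        G.mlog_mem (G.mul_mem (hWG j) ih) ((norm_mul_fedIter_sub_one_le hδ hW j k).trans hρ)
    have hc : (Fintype.card ι : ℂ)⁻¹ = (((Fintype.card ι : ℝ)⁻¹ : ℝ) : ℂ) := by
      rw [Complex.ofReal_inv, Complex.ofReal_natCast]
    rw [fed_def, hc, Complex.coe_smul]
    exact G.lie.smul_mem _ hsum

/-- **(0.9) FOR FEDERBUSH'S SOLUTION OF (0.10) ON EVERY LOG-CHARTED CLOSED SUBGROUP `G`**: if `W_j ∈ G`,
`‖W_j − 1‖ ≤ δ ≤ 1/100` and `4δ ≤ ρ`, then `fedSol W ∈ G` (the Newton iterates lie in `G`, converge to `fedSol W`,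
and `G` is closed).  Print: «if 𝐔_j ∈ G, then M({𝐔_j}) ∈ G also. (0.9)» for «G … a Lie subgroup of a group of
complex unitary matrices». [cite: Balaban1987RG1, (0.9) p.253] -/
theorem fedSol_mem_logChart (G : LogChart 𝔸) {δ : ℝ} (hδ : δ ≤ 1 / 100) (hρ : 4 * δ ≤ G.ρ) {W : ι → 𝔸}
    (hW : ∀ j, ‖W j - 1‖ ≤ δ) (hWG : ∀ j, W j ∈ G.carrier) : fedSol W ∈ G.carrier :=
  G.isClosed.mem_of_tendsto (tendsto_fedIter hδ hW) (Eventually.of_forall (fedIter_mem G hδ hρ hW hWG))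

end Newton

/-! ## §4b (0.9) for the group average `fedM δ` on matrix families -/

section Mean

open scoped Matrix.Norms.L2Operator

variable {n : Type*} [Fintype n] [DecidableEq n]
variable {m : ℕ} {δ : ℝ} {U : Fin (m + 1) → Matrix n n ℂ}

/-- **(0.9) FOR THE GROUP AVERAGE `M = fedM δ` ON EVERY LOG-CHARTED `G` CLOSED UNDER `*`**: a `G`-valued matrix
family has `fedM δ U ∈ G` (`δ ≤ 1/100`, `4δ ≤ ρ`; on the guard `M = (fedSol (U_j U₀*))* U₀` with `U_j U₀* ∈ G`
`δ`-close to `1`, off the guard `M = U₀`).  For print's `G ⊆ U(N)` the adjoint is the inverse, so «closed under `*`»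
is «subgroup»; the instances of §2 are `U(N)` and `SU(N)`. [cite: Balaban1987RG1, (0.9) p.253] -/
theorem fedM_mem_logChart (G : LogChart (Matrix n n ℂ)) (hGstar : ∀ ⦃g⦄, g ∈ G.carrier → star g ∈ G.carrier)
    (hU : ∀ j, U j ∈ G.carrier) (hδ : δ ≤ 1 / 100) (hρ : 4 * δ ≤ G.ρ) : fedM δ U ∈ G.carrier := by
  by_cases h : ∀ i k, ‖U i * star (U k) - 1‖ < δ
  · rw [fedM_of_small h]
    have hrelG : ∀ j, rel U 0 j ∈ G.carrier := fun j => by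
      rw [rel_apply]; exact G.mul_mem (hU j) (hGstar (hU 0))
    have hrel : ∀ j, ‖rel U 0 j - 1‖ ≤ δ := fun j => by rw [rel_apply]; exact (h j 0).le
    exact G.mul_mem (hGstar (fedSol_mem_logChart G hδ hρ hrel hrelG)) (hU 0)
  · rw [fedM_of_not_small h]; exact hU 0

end Mean

/-! ## §5 Corollaries for the tree's constructions on `U(N)`, `SU(N)`, `SL(N, ℂ)` -/

section Corollaries

open scoped Matrix.Norms.L2Operator

variable {n : Type*} [Fintype n] [DecidableEq n]
variable {ι : Type*} [Fintype ι] [Nonempty ι]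

/-- (0.9) on `U(N)` through the general theorem: `fedSol W ∈ U(N)` for unitary families of radius `δ ≤ 1/100`
(re-deriving the base module's `fedSol_mem_unitaryGroup`, whose hypothesis is the case `δ = 1/100`).
[cite: Balaban1987RG1, (0.9) p.253] -/
theorem fedSol_mem_unitaryGroup_of_chart {δ : ℝ} (hδ : δ ≤ 1 / 100) {W : ι → Matrix n n ℂ}
    (hWu : ∀ j, W j ∈ Matrix.unitaryGroup n ℂ) (hW : ∀ j, ‖W j - 1‖ ≤ δ) :
    fedSol W ∈ Matrix.unitaryGroup n ℂ :=
  fedSol_mem_logChart (unitaryLogChart n) hδ (by rw [unitaryLogChart_ρ]; linarith) hW hWu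

variable [Nonempty n]

/-- **(0.9) on `SU(N)` for `N·δ ≤ 3/4`**: `fedSol W ∈ SU(N)` for `SU(N)`-families of radius `δ ≤ min(1/100, 3/(4N))`
(the base module's `fedSol_mem_specialUnitaryGroup` has `N·δ ≤ 1/3`; the sharp radius `2 sin(π/N)` is
`BlockAveragingFederbushRadiusExact.fedSol_mem_specialUnitaryGroup_of_norm_lt_two_sin`). [cite: Balaban1987RG1, (0.9) p.253] -/
theorem fedSol_mem_specialUnitaryGroup_of_chart {δ : ℝ} (hδ : δ ≤ 1 / 100)
    (hδN : (Fintype.card n : ℝ) * δ ≤ 3 / 4) {W : ι → Matrix n n ℂ}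
    (hWs : ∀ j, W j ∈ Matrix.specialUnitaryGroup n ℂ) (hW : ∀ j, ‖W j - 1‖ ≤ δ) :
    fedSol W ∈ Matrix.specialUnitaryGroup n ℂ := by
  refine fedSol_mem_logChart (specialUnitaryLogChart n) hδ ?_ hW hWs
  have hN : (0 : ℝ) < Fintype.card n := Nat.cast_pos.mpr Fintype.card_pos
  rw [specialUnitaryLogChart_ρ]
  refine le_min (by linarith) ?_
  rw [le_div_iff₀ hN]
  linarith

/-- **(0.9) on the complexification `SL(N, ℂ)` for `N·δ ≤ 3/4`**: `det (fedSol W) = 1` for families of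
determinant-one matrices of radius `δ ≤ min(1/100, 3/(4N))` (cf. `BlockAveragingFederbushRadius.det_fedSol_eq_one_of_det_eq_one`
under `N·δ ≤ 1/3`, and `BlockAveragingFederbushRadiusExact.det_fedSol_pow_card_eq_one`: at radius `1/100` alone only
`(det fedSol W)^{|I|} = 1`). [cite: Balaban1987RG1, (0.9) p.253] -/
theorem det_fedSol_eq_one_of_chart {δ : ℝ} (hδ : δ ≤ 1 / 100) (hδN : (Fintype.card n : ℝ) * δ ≤ 3 / 4)
    {W : ι → Matrix n n ℂ} (hWd : ∀ j, (W j).det = 1) (hW : ∀ j, ‖W j - 1‖ ≤ δ) : (fedSol W).det = 1 := by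
  refine (mem_specialLinearLogChart_carrier).1 (fedSol_mem_logChart (specialLinearLogChart n) hδ ?_ hW hWd)
  have hN : (0 : ℝ) < Fintype.card n := Nat.cast_pos.mpr Fintype.card_pos
  rw [specialLinearLogChart_ρ]
  refine le_min (by linarith) ?_
  rw [le_div_iff₀ hN]
  linarith

variable {m : ℕ} {δ : ℝ} {U : Fin (m + 1) → Matrix n n ℂ}

omit [Nonempty n] in
/-- (0.9) for `M = fedM δ` on `U(N)` through the general theorem (the base module's `fedM_mem_unitaryGroup`,
re-derived): unitary families have unitary average for every `δ ≤ 1/100`. [cite: Balaban1987RG1, (0.9) p.253] -/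
theorem fedM_mem_unitaryGroup_of_chart (hU : ∀ j, U j ∈ Matrix.unitaryGroup n ℂ) (hδ : δ ≤ 1 / 100) :
    fedM δ U ∈ (unitaryLogChart n).carrier :=
  fedM_mem_logChart (unitaryLogChart n) (fun _ hg => Unitary.star_mem hg) hU hδ
    (by rw [unitaryLogChart_ρ]; linarith)

/-- **(0.9) for `M = fedM δ` on `SU(N)` for `δ ≤ 1/100`, `N·δ ≤ 3/4`** (base module: `N·δ ≤ 1/3`; sharp:
`BlockAveragingFederbushRadiusExact.fedM_mem_specialUnitaryGroup_of_le_two_sin`). [cite: Balaban1987RG1, (0.9) p.253] -/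
theorem fedM_mem_specialUnitaryGroup_of_chart (hU : ∀ j, U j ∈ Matrix.specialUnitaryGroup n ℂ)
    (hδ : δ ≤ 1 / 100) (hδN : (Fintype.card n : ℝ) * δ ≤ 3 / 4) :
    fedM δ U ∈ Matrix.specialUnitaryGroup n ℂ := by
  have hN : (0 : ℝ) < Fintype.card n := Nat.cast_pos.mpr Fintype.card_pos
  have hρ : 4 * δ ≤ (specialUnitaryLogChart n).ρ := by
    rw [specialUnitaryLogChart_ρ]
    refine le_min (by linarith) ?_
    rw [le_div_iff₀ hN]
    linarith
  exact fedM_mem_logChart (specialUnitaryLogChart n) (fun _ hg => star_mem_SU hg) hU hδ hρ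

/-! ### Non-vacuity: the hypotheses of the general theorems are met by the tree's inhabitants -/

/-- The radius `1/100` of the tree's `federbushU` satisfies `4δ ≤ ρ` for the `U(N)` chart. [folklore] -/
example : 4 * (1 / 100 : ℝ) ≤ (unitaryLogChart n).ρ := by rw [unitaryLogChart_ρ]; norm_num

/-- The radius `deltaFed n = min(1/100, 1/(3N))` of the tree's `federbushSU` satisfies the hypotheses of
`fedM_mem_specialUnitaryGroup_of_chart`: its values are re-certified in `SU(N)` by the general theorem. [folklore] -/
example (hU : ∀ j, U j ∈ Matrix.specialUnitaryGroup n ℂ) : fedM (deltaFed n) U ∈ Matrix.specialUnitaryGroup n ℂ :=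
  fedM_mem_specialUnitaryGroup_of_chart hU deltaFed_le (card_mul_deltaFed_le.trans (by norm_num))

/-- The constant family at `1 ∈ SU(N)` meets every hypothesis of `fedSol_mem_logChart` for the `SU(N)` chart with
`δ = 0`. [folklore] -/
example : fedSol (fun _ : ι => (1 : Matrix n n ℂ)) ∈ (specialUnitaryLogChart n).carrier :=
  fedSol_mem_logChart (specialUnitaryLogChart n) (δ := 0) (by norm_num)
    (by rw [mul_zero]; exact (specialUnitaryLogChart n).ρ_pos.le)
    (fun _ => by simp) (fun _ => (specialUnitaryLogChart n).one_mem)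

end Corollaries

end FederbushMean

/-! ## §6 (v1.1) Intersections of charts; the real structure of `M_N(ℂ)`; the real groups `O(N)`, `SO(N)` and their
complexifications `O(N, ℂ)`, `SO(N, ℂ)` -/

section Inf

variable {𝔸 : Type*} [NormedRing 𝔸] [NormedAlgebra ℂ 𝔸]

/-- **INTERSECTION OF TWO LOG-CHARTED CLOSED SUBGROUPS** is log-charted: carrier `G₁ ∩ G₂`, Lie algebra `𝔤₁ ⊓ 𝔤₂`,
radius `min ρ₁ ρ₂`. [folklore] -/
def LogChart.inf (G₁ G₂ : LogChart 𝔸) : LogChart 𝔸 where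
  carrier := G₁.carrier ∩ G₂.carrier
  lie := G₁.lie ⊓ G₂.lie
  ρ := min G₁.ρ G₂.ρ
  ρ_pos := lt_min G₁.ρ_pos G₂.ρ_pos
  one_mem := ⟨G₁.one_mem, G₂.one_mem⟩
  mul_mem := fun _ _ ha hb => ⟨G₁.mul_mem ha.1 hb.1, G₂.mul_mem ha.2 hb.2⟩
  isClosed := G₁.isClosed.inter G₂.isClosed
  exp_mem := fun _ hA => ⟨G₁.exp_mem (Submodule.mem_inf.1 hA).1, G₂.exp_mem (Submodule.mem_inf.1 hA).2⟩
  mlog_mem := fun _ hg hs => Submodule.mem_inf.2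
    ⟨G₁.mlog_mem hg.1 (hs.trans (min_le_left _ _)), G₂.mlog_mem hg.2 (hs.trans (min_le_right _ _))⟩

/-- The carrier of `G₁.inf G₂` is `G₁ ∩ G₂`. [folklore] -/
@[simp] theorem LogChart.inf_carrier (G₁ G₂ : LogChart 𝔸) :
    (G₁.inf G₂).carrier = G₁.carrier ∩ G₂.carrier := rfl

/-- The Lie algebra of `G₁.inf G₂` is `𝔤₁ ⊓ 𝔤₂`. [folklore] -/
@[simp] theorem LogChart.inf_lie (G₁ G₂ : LogChart 𝔸) : (G₁.inf G₂).lie = G₁.lie ⊓ G₂.lie := rfl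

/-- The radius of `G₁.inf G₂` is `min ρ₁ ρ₂`. [folklore] -/
@[simp] theorem LogChart.inf_ρ (G₁ G₂ : LogChart 𝔸) : (G₁.inf G₂).ρ = min G₁.ρ G₂.ρ := rfl

end Inf

section RealStructure

open scoped Matrix.Norms.L2Operator

variable {n : Type*} [Fintype n] [DecidableEq n]

/-- Entrywise complex conjugation of `M_N(ℂ)`, a ring endomorphism (Mathlib's `RingHom.mapMatrix` of `conj`).
[folklore] -/
def conjEntry (n : Type*) [Fintype n] [DecidableEq n] : Matrix n n ℂ →+* Matrix n n ℂ :=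
  (starRingEnd ℂ).mapMatrix

/-- `conjEntry A = A.map conj`. [folklore] -/
@[simp] theorem conjEntry_apply (A : Matrix n n ℂ) : conjEntry n A = A.map (starRingEnd ℂ) := rfl

/-- Entrywise conjugation is continuous. [folklore] -/
theorem continuous_conjEntry : Continuous (conjEntry n) :=
  continuous_id.matrix_map Complex.continuous_conj

/-- Entrywise conjugation is an involution. [folklore] -/
@[simp] theorem conjEntry_conjEntry (A : Matrix n n ℂ) : conjEntry n (conjEntry n A) = A := by
  ext i j; simp

/-- Entrywise conjugation commutes with real scalars. [folklore] -/
theorem conjEntry_real_smul (c : ℝ) (A : Matrix n n ℂ) : conjEntry n (c • A) = c • conjEntry n A := by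
  ext i j; simp [Matrix.map_apply, Complex.real_smul]

/-- Entrywise conjugation conjugates complex scalars. [folklore] -/
theorem conjEntry_smul (c : ℂ) (A : Matrix n n ℂ) : conjEntry n (c • A) = starRingEnd ℂ c • conjEntry n A := by
  ext i j; simp [Matrix.map_apply]

/-- Entrywise conjugation commutes with the adjoint: `conj (A*) = (conj A)*`. [folklore] -/
theorem conjEntry_star (A : Matrix n n ℂ) : conjEntry n (star A) = star (conjEntry n A) := by
  ext i j; simp [Matrix.map_apply, Matrix.star_apply]

/-- **THE REAL MATRICES** `M_N(ℝ) ⊂ M_N(ℂ)` as a real-linear subspace: the fixed points of entrywise conjugation.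
[folklore] -/
def realMatrix (n : Type*) [Fintype n] [DecidableEq n] : Submodule ℝ (Matrix n n ℂ) where
  carrier := {A | conjEntry n A = A}
  add_mem' := fun {a b} (ha : conjEntry n a = a) (hb : conjEntry n b = b) => by
    show conjEntry n (a + b) = a + b
    rw [map_add, ha, hb]
  zero_mem' := by show conjEntry n 0 = 0; exact map_zero _
  smul_mem' := fun c a (ha : conjEntry n a = a) => by
    show conjEntry n (c • a) = c • a
    rw [conjEntry_real_smul, ha]

/-- Membership in `realMatrix n`: `conj A = A` entrywise. [folklore] -/
@[simp] theorem mem_realMatrix {A : Matrix n n ℂ} : A ∈ realMatrix n ↔ conjEntry n A = A := Iff.rfl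

/-- A matrix fixed by entrywise conjugation has its exponential fixed (`exp` commutes with continuous ring
homomorphisms, Mathlib `map_exp`). [folklore] -/
theorem conjEntry_exp (A : Matrix n n ℂ) : conjEntry n (exp A) = exp (conjEntry n A) := by
  letI : NormedAlgebra ℚ (Matrix n n ℂ) := NormedAlgebra.restrictScalars ℚ ℂ _
  exact map_exp (conjEntry n) continuous_conjEntry A

/-- The coefficients `(−1)^{n+1}/n` of the series (21) are real. [folklore] -/
theorem conj_logSeriesCoeff (k : ℕ) :
    starRingEnd ℂ (Literature.Analysis.Complex.logSeriesCoeff k) = Literature.Analysis.Complex.logSeriesCoeff k := by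
  simp [Literature.Analysis.Complex.logSeriesCoeff, map_div₀]

/-- **`log` OF A REAL MATRIX IS REAL** (inside the domain of the series (21)): entrywise conjugation is a continuous
ring endomorphism fixing `A − 1` and the real coefficients of (21), hence every partial sum, hence the sum.
[folklore] -/
theorem conjEntry_mlog {A : Matrix n n ℂ} (hA : ‖A - 1‖ < 1) (hreal : conjEntry n A = A) :
    conjEntry n (mlog A) = mlog A := by
  have h1 := hasSum_mlog hA
  have h2 : HasSum (fun k : ℕ => conjEntry n (Literature.Analysis.Complex.logSeriesCoeff k • (A - 1) ^ k))
      (conjEntry n (mlog A)) := h1.map (conjEntry n) continuous_conjEntry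
  have h3 : (fun k : ℕ => conjEntry n (Literature.Analysis.Complex.logSeriesCoeff k • (A - 1) ^ k))
      = fun k => Literature.Analysis.Complex.logSeriesCoeff k • (A - 1) ^ k := by
    funext k
    rw [conjEntry_smul, conj_logSeriesCoeff, map_pow, map_sub, map_one, hreal]
  rw [h3] at h2
  exact h2.unique h1

/-- **THE REAL MATRICES ARE LOG-CHARTED** (as a closed multiplicative system, not a group): carrier and Lie algebra
both `M_N(ℝ) ⊂ M_N(ℂ)`, `ρ = 1/2` — the device that turns every chart of §2 into the chart of its real form by
`LogChart.inf`. [folklore] -/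
def realLogChart (n : Type*) [Fintype n] [DecidableEq n] : LogChart (Matrix n n ℂ) where
  carrier := {A | conjEntry n A = A}
  lie := realMatrix n
  ρ := 1 / 2
  ρ_pos := by norm_num
  one_mem := map_one (conjEntry n)
  mul_mem := fun a b (ha : conjEntry n a = a) (hb : conjEntry n b = b) => by
    show conjEntry n (a * b) = a * b
    rw [map_mul, ha, hb]
  isClosed := isClosed_eq continuous_conjEntry continuous_id
  exp_mem := fun A (hA : conjEntry n A = A) => by
    show conjEntry n (exp A) = exp A
    rw [conjEntry_exp, hA]
  mlog_mem := fun g (hg : conjEntry n g = g) hs => by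
    show conjEntry n (mlog g) = mlog g
    exact conjEntry_mlog (by linarith) hg

/-- Membership in the carrier of the real chart: `conj A = A` entrywise. [folklore] -/
@[simp] theorem mem_realLogChart_carrier {A : Matrix n n ℂ} :
    A ∈ (realLogChart n).carrier ↔ conjEntry n A = A := Iff.rfl

/-- The Lie algebra of the real chart is `M_N(ℝ)`. [folklore] -/
@[simp] theorem realLogChart_lie : (realLogChart n).lie = realMatrix n := rfl

/-- The radius of the real chart is `1/2`. [folklore] -/
@[simp] theorem realLogChart_ρ : (realLogChart n).ρ = 1 / 2 := rfl

/-- **`O(N)` IS LOG-CHARTED**: the real orthogonal group realised in `M_N(ℂ)` as `U(N) ∩ M_N(ℝ)`, Lie algebra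
`𝔬(N) = 𝔲(N) ∩ M_N(ℝ)` (the real antisymmetric matrices), `ρ = 1/3`. [folklore] -/
def orthogonalLogChart (n : Type*) [Fintype n] [DecidableEq n] : LogChart (Matrix n n ℂ) :=
  (unitaryLogChart n).inf (realLogChart n)

/-- Membership in the `O(N)` chart: unitary with real entries. [folklore] -/
@[simp] theorem mem_orthogonalLogChart_carrier {A : Matrix n n ℂ} :
    A ∈ (orthogonalLogChart n).carrier ↔ A ∈ Matrix.unitaryGroup n ℂ ∧ conjEntry n A = A := Iff.rfl

/-- The Lie algebra of the `O(N)` chart: `A* = −A` and `conj A = A` (real antisymmetric). [folklore] -/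
@[simp] theorem mem_orthogonalLogChart_lie {A : Matrix n n ℂ} :
    A ∈ (orthogonalLogChart n).lie ↔ star A = -A ∧ conjEntry n A = A := by
  show A ∈ (unitaryLogChart n).lie ⊓ realMatrix n ↔ _
  rw [Submodule.mem_inf, mem_unitaryLogChart_lie, mem_realMatrix]

/-- The radius of the `O(N)` chart is `1/3`. [folklore] -/
@[simp] theorem orthogonalLogChart_ρ : (orthogonalLogChart n).ρ = 1 / 3 := by
  show min (1 / 3 : ℝ) (1 / 2) = 1 / 3
  norm_num

/-- A unitary matrix with real entries is orthogonal: `Aᵀ A = 1`. [folklore] -/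
theorem transpose_mul_self_of_mem_orthogonalLogChart {A : Matrix n n ℂ} (hA : A ∈ (orthogonalLogChart n).carrier) :
    A.transpose * A = 1 := by
  obtain ⟨hU, hreal⟩ := hA
  have h1 : star A * A = 1 := Matrix.mem_unitaryGroup_iff'.1 hU
  have hreal' : A.map (starRingEnd ℂ) = A := hreal
  have h2 : star A = A.transpose := by
    ext i j
    have hij : starRingEnd ℂ (A j i) = A j i := by
      have := congrFun (congrFun hreal' j) i
      simpa [Matrix.map_apply] using this
    simpa [Matrix.star_apply, Matrix.transpose_apply] using hij
  rwa [h2] at h1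

variable [Nonempty n]

/-- **`SO(N)` IS LOG-CHARTED**: `SU(N) ∩ M_N(ℝ)`, Lie algebra `𝔰𝔲(N) ∩ M_N(ℝ)` (real antisymmetric, automatically
traceless), `ρ = min(min(1/3, 3/N), 1/2)`. [folklore] -/
def specialOrthogonalLogChart (n : Type*) [Fintype n] [DecidableEq n] [Nonempty n] : LogChart (Matrix n n ℂ) :=
  (specialUnitaryLogChart n).inf (realLogChart n)

/-- Membership in the `SO(N)` chart: special unitary with real entries. [folklore] -/
@[simp] theorem mem_specialOrthogonalLogChart_carrier {A : Matrix n n ℂ} :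
    A ∈ (specialOrthogonalLogChart n).carrier ↔ A ∈ Matrix.specialUnitaryGroup n ℂ ∧ conjEntry n A = A := Iff.rfl

/-- The radius of the `SO(N)` chart. [folklore] -/
@[simp] theorem specialOrthogonalLogChart_ρ :
    (specialOrthogonalLogChart n).ρ = min (min (1 / 3) (3 / (Fintype.card n : ℝ))) (1 / 2) := rfl

end RealStructure

section ComplexOrthogonal

open scoped Matrix.Norms.L2Operator

variable {n : Type*} [Fintype n] [DecidableEq n]

/-- `‖e^X − 1‖ ≤ e^{‖X‖} − 1` (termwise comparison of the exponential series; the tree's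
`OneLinkLaplace.norm_exp_sub_one_sub_le`). [folklore] -/
theorem norm_exp_sub_one_le_exp_norm_sub_one (X : Matrix n n ℂ) : ‖exp X - 1‖ ≤ Real.exp ‖X‖ - 1 := by
  have h := OneLinkLaplace.norm_exp_sub_one_sub_le X
  have h2 : ‖exp X - 1‖ ≤ ‖exp X - 1 - X‖ + ‖X‖ := by
    have := norm_add_le (exp X - 1 - X) X
    rwa [sub_add_cancel] at this
  linarith

/-- The inverse of a matrix in the domain of (21) is `e^{−log g}`. [folklore] -/
theorem inv_eq_exp_neg_mlog {g : Matrix n n ℂ} (hg : ‖g - 1‖ < 1) : g⁻¹ = exp (-mlog g) := by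
  letI : NormedAlgebra ℚ (Matrix n n ℂ) := NormedAlgebra.restrictScalars ℚ ℂ _
  have h : exp (-mlog g) * exp (mlog g) = 1 := by
    rw [← exp_add_of_commute (Commute.refl (mlog g)).neg_left, neg_add_cancel, exp_zero]
  rw [exp_mlog hg] at h
  exact Matrix.inv_eq_left_inv h

/-- `‖log g‖ ≤ 1/2` for `‖g − 1‖ ≤ 1/3` ((26): `|log X| ≤ |X − 1|/(1 − |X − 1|)`). [folklore] -/
theorem norm_mlog_le_half {g : Matrix n n ℂ} (hg : ‖g - 1‖ ≤ 1 / 3) : ‖mlog g‖ ≤ 1 / 2 := by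
  have hg1 : ‖g - 1‖ < 1 := by linarith
  refine (norm_mlog_le_div hg1).trans ?_
  rw [div_le_iff₀ (by linarith)]
  linarith

/-- `‖g⁻¹ − 1‖ < 1` for `‖g − 1‖ ≤ 1/3`: `g⁻¹ = e^{−log g}`, `‖e^{−log g} − 1‖ ≤ e^{1/2} − 1 < 1`. [folklore] -/
theorem norm_inv_sub_one_lt_one {g : Matrix n n ℂ} (hg : ‖g - 1‖ ≤ 1 / 3) : ‖g⁻¹ - 1‖ < 1 := by
  have hg1 : ‖g - 1‖ < 1 := by linarith
  rw [inv_eq_exp_neg_mlog hg1]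
  refine (norm_exp_sub_one_le_exp_norm_sub_one _).trans_lt ?_
  rw [norm_neg]
  have hL := norm_mlog_le_half hg
  have h1 : Real.exp ‖mlog g‖ ≤ Real.exp (1 / 2) := Real.exp_le_exp.2 hL
  have h2 : Real.exp (1 / 2 : ℝ) < 2 := by
    have he : Real.exp (1 / 2 : ℝ) * Real.exp (1 / 2) = Real.exp 1 := by
      rw [← Real.exp_add]; norm_num
    nlinarith [Real.exp_one_lt_d9, Real.exp_pos (1 / 2 : ℝ)]
  linarith

/-- **`log g⁻¹ = −log g`** for `‖g − 1‖ ≤ 1/3` (`g⁻¹ = e^{−log g}` and the tree's `B7BlockAvgLog.mlog_exp` on the ball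
of radius `ln 2 > 1/2 ≥ ‖log g‖`). [folklore] -/
theorem mlog_inv {g : Matrix n n ℂ} (hg : ‖g - 1‖ ≤ 1 / 3) : mlog g⁻¹ = -mlog g := by
  have hg1 : ‖g - 1‖ < 1 := by linarith
  rw [inv_eq_exp_neg_mlog hg1]
  refine B7BlockAvgLog.mlog_exp ?_
  rw [norm_neg]
  exact (norm_mlog_le_half hg).trans_lt (by have := Real.log_two_gt_d9; linarith)

/-- The transpose of the series (21): `Σ c_k (gᵀ − 1)^k = (log g)ᵀ` whenever the series for `g` converges (no
hypothesis on `‖gᵀ − 1‖`). [folklore] -/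
theorem hasSum_mlog_transpose {g : Matrix n n ℂ} (hg : ‖g - 1‖ < 1) :
    HasSum (fun k : ℕ => Literature.Analysis.Complex.logSeriesCoeff k • (g.transpose - 1) ^ k)
      (mlog g).transpose := by
  have h := (hasSum_mlog hg).matrix_transpose
  simpa [Matrix.transpose_smul, Matrix.transpose_pow, Matrix.transpose_sub] using h

/-- **`log` OF A COMPLEX ORTHOGONAL MATRIX IS ANTISYMMETRIC**: `gᵀ g = 1`, `‖g − 1‖ ≤ 1/3` ⟹ `(log g)ᵀ = −log g`
(`gᵀ = g⁻¹`, the transposed series is the series of `g⁻¹`, and `log g⁻¹ = −log g`). [folklore] -/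
theorem transpose_mlog_eq_neg {g : Matrix n n ℂ} (hgo : g.transpose * g = 1) (hg : ‖g - 1‖ ≤ 1 / 3) :
    (mlog g).transpose = -mlog g := by
  have hg1 : ‖g - 1‖ < 1 := by linarith
  have hinv : g⁻¹ = g.transpose := Matrix.inv_eq_left_inv hgo
  have h1 := hasSum_mlog_transpose hg1
  have h2 := hasSum_mlog (norm_inv_sub_one_lt_one hg)
  rw [← hinv] at h1
  rw [h1.unique h2, mlog_inv hg]

/-- **THE ANTISYMMETRIC COMPLEX MATRICES** `{A : Aᵀ = −A}` (the Lie algebra `𝔬(N, ℂ) = 𝔬(N)ᶜ`) as a real-linear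
subspace. [folklore] -/
def skewSymmMatrix (n : Type*) [Fintype n] [DecidableEq n] : Submodule ℝ (Matrix n n ℂ) where
  carrier := {A | A.transpose = -A}
  add_mem' := fun {a b} (ha : a.transpose = -a) (hb : b.transpose = -b) => by
    show (a + b).transpose = -(a + b)
    rw [Matrix.transpose_add, ha, hb, neg_add]
  zero_mem' := by show (0 : Matrix n n ℂ).transpose = -0; simp
  smul_mem' := fun c a (ha : a.transpose = -a) => by
    show (c • a).transpose = -(c • a)
    rw [Matrix.transpose_smul, ha, smul_neg]

/-- Membership in `skewSymmMatrix n`: `Aᵀ = −A`. [folklore] -/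
@[simp] theorem mem_skewSymmMatrix {A : Matrix n n ℂ} : A ∈ skewSymmMatrix n ↔ A.transpose = -A := Iff.rfl

/-- **THE COMPLEX ORTHOGONAL GROUP `O(N, ℂ) = {gᵀ g = 1}` — THE COMPLEXIFICATION OF `O(N)` — IS LOG-CHARTED**:
Lie algebra the antisymmetric complex matrices, `ρ = 1/3` (`(e^A)ᵀ e^A = e^{−A} e^A = 1`, Mathlib
`Matrix.exp_transpose`; `(log g)ᵀ = −log g`, `transpose_mlog_eq_neg`).  Print p. 253: the operation `M` is «a
Gᶜ-valued function»; for `G = SO(N)`, `Gᶜ = SO(N, ℂ) = O(N, ℂ) ∩ SL(N, ℂ)` (`specialComplexOrthogonalLogChart`).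
[folklore] -/
def complexOrthogonalLogChart (n : Type*) [Fintype n] [DecidableEq n] : LogChart (Matrix n n ℂ) where
  carrier := {A | A.transpose * A = 1}
  lie := skewSymmMatrix n
  ρ := 1 / 3
  ρ_pos := by norm_num
  one_mem := by show (1 : Matrix n n ℂ).transpose * 1 = 1; simp
  mul_mem := fun a b (ha : a.transpose * a = 1) (hb : b.transpose * b = 1) => by
    show (a * b).transpose * (a * b) = 1
    rw [Matrix.transpose_mul, Matrix.mul_assoc, ← Matrix.mul_assoc a.transpose, ha, Matrix.one_mul, hb]
  isClosed := isClosed_eq (continuous_id.matrix_transpose.mul continuous_id) continuous_const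
  exp_mem := fun A (hA : A.transpose = -A) => by
    letI : NormedAlgebra ℚ (Matrix n n ℂ) := NormedAlgebra.restrictScalars ℚ ℂ _
    show (exp A).transpose * exp A = 1
    rw [← Matrix.exp_transpose, hA, ← exp_add_of_commute (Commute.refl A).neg_left, neg_add_cancel, exp_zero]
  mlog_mem := fun g (hg : g.transpose * g = 1) hs => transpose_mlog_eq_neg hg hs

/-- Membership in the `O(N, ℂ)` chart: `Aᵀ A = 1`. [folklore] -/
@[simp] theorem mem_complexOrthogonalLogChart_carrier {A : Matrix n n ℂ} :
    A ∈ (complexOrthogonalLogChart n).carrier ↔ A.transpose * A = 1 := Iff.rfl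

/-- The Lie algebra of the `O(N, ℂ)` chart: `Aᵀ = −A`. [folklore] -/
@[simp] theorem mem_complexOrthogonalLogChart_lie {A : Matrix n n ℂ} :
    A ∈ (complexOrthogonalLogChart n).lie ↔ A.transpose = -A := Iff.rfl

/-- The radius of the `O(N, ℂ)` chart is `1/3`. [folklore] -/
@[simp] theorem complexOrthogonalLogChart_ρ : (complexOrthogonalLogChart n).ρ = 1 / 3 := rfl

/-- `O(N) ⊂ O(N, ℂ)`: a unitary matrix with real entries is complex orthogonal. [folklore] -/
theorem orthogonalLogChart_carrier_subset :
    (orthogonalLogChart n).carrier ⊆ (complexOrthogonalLogChart n).carrier :=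
  fun _ hA => transpose_mul_self_of_mem_orthogonalLogChart hA

variable [Nonempty n]

/-- **`SO(N, ℂ) = O(N, ℂ) ∩ SL(N, ℂ)` — THE COMPLEXIFICATION `Gᶜ` OF `G = SO(N)` — IS LOG-CHARTED** (intersection
of the two charts; `ρ = min(1/3, min(1/3, 3/N))`). [folklore] -/
def specialComplexOrthogonalLogChart (n : Type*) [Fintype n] [DecidableEq n] [Nonempty n] :
    LogChart (Matrix n n ℂ) :=
  (complexOrthogonalLogChart n).inf (specialLinearLogChart n)

/-- Membership in the `SO(N, ℂ)` chart: `Aᵀ A = 1` and `det A = 1`. [folklore] -/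
@[simp] theorem mem_specialComplexOrthogonalLogChart_carrier {A : Matrix n n ℂ} :
    A ∈ (specialComplexOrthogonalLogChart n).carrier ↔ A.transpose * A = 1 ∧ A.det = 1 := Iff.rfl

/-- The radius of the `SO(N, ℂ)` chart. [folklore] -/
@[simp] theorem specialComplexOrthogonalLogChart_ρ :
    (specialComplexOrthogonalLogChart n).ρ = min (1 / 3) (min (1 / 3) (3 / (Fintype.card n : ℝ))) := rfl

/-- `SO(N) ⊂ SO(N, ℂ)`. [folklore] -/
theorem specialOrthogonalLogChart_carrier_subset :
    (specialOrthogonalLogChart n).carrier ⊆ (specialComplexOrthogonalLogChart n).carrier :=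
  fun _ hA => ⟨transpose_mul_self_of_mem_orthogonalLogChart ⟨(Matrix.mem_specialUnitaryGroup_iff.1 hA.1).1, hA.2⟩,
    (Matrix.mem_specialUnitaryGroup_iff.1 hA.1).2⟩

end ComplexOrthogonal

namespace FederbushMean

section RealCorollaries

open scoped Matrix.Norms.L2Operator

variable {n : Type*} [Fintype n] [DecidableEq n]
variable {ι : Type*} [Fintype ι] [Nonempty ι]

/-- The carrier of the real chart is closed under the adjoint. [folklore] -/
theorem star_mem_realLogChart {g : Matrix n n ℂ} (hg : g ∈ (realLogChart n).carrier) :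
    star g ∈ (realLogChart n).carrier := by
  rw [mem_realLogChart_carrier] at hg ⊢
  rw [conjEntry_star, hg]

/-- **(0.9) on `O(N)`**: `fedSol W` is unitary with real entries for `O(N)`-families of radius `δ ≤ 1/100`.
[cite: Balaban1987RG1, (0.9) p.253] -/
theorem fedSol_mem_orthogonal_of_chart {δ : ℝ} (hδ : δ ≤ 1 / 100) {W : ι → Matrix n n ℂ}
    (hWo : ∀ j, W j ∈ (orthogonalLogChart n).carrier) (hW : ∀ j, ‖W j - 1‖ ≤ δ) :
    fedSol W ∈ (orthogonalLogChart n).carrier :=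
  fedSol_mem_logChart (orthogonalLogChart n) hδ (by rw [orthogonalLogChart_ρ]; linarith) hW hWo

variable {m : ℕ} {δ : ℝ} {U : Fin (m + 1) → Matrix n n ℂ}

/-- **(0.9) for `M = fedM δ` on `O(N)`**: families of real unitary matrices have a real unitary average, for every
`δ ≤ 1/100`. [cite: Balaban1987RG1, (0.9) p.253] -/
theorem fedM_mem_orthogonal_of_chart (hU : ∀ j, U j ∈ (orthogonalLogChart n).carrier) (hδ : δ ≤ 1 / 100) :
    fedM δ U ∈ (orthogonalLogChart n).carrier :=
  fedM_mem_logChart (orthogonalLogChart n)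
    (fun _ hg => ⟨Unitary.star_mem hg.1, star_mem_realLogChart hg.2⟩) hU hδ
    (by rw [orthogonalLogChart_ρ]; linarith)

variable [Nonempty n]

/-- **(0.9) on `SO(N)` for `N·δ ≤ 3/4`**: `fedSol W ∈ SO(N)` (special unitary with real entries) for
`SO(N)`-families of radius `δ ≤ min(1/100, 3/(4N))`. [cite: Balaban1987RG1, (0.9) p.253] -/
theorem fedSol_mem_specialOrthogonal_of_chart {δ : ℝ} (hδ : δ ≤ 1 / 100)
    (hδN : (Fintype.card n : ℝ) * δ ≤ 3 / 4) {W : ι → Matrix n n ℂ}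
    (hWs : ∀ j, W j ∈ (specialOrthogonalLogChart n).carrier) (hW : ∀ j, ‖W j - 1‖ ≤ δ) :
    fedSol W ∈ (specialOrthogonalLogChart n).carrier := by
  refine fedSol_mem_logChart (specialOrthogonalLogChart n) hδ ?_ hW hWs
  have hN : (0 : ℝ) < Fintype.card n := Nat.cast_pos.mpr Fintype.card_pos
  rw [specialOrthogonalLogChart_ρ]
  refine le_min (le_min (by linarith) ?_) (by linarith)
  rw [le_div_iff₀ hN]
  linarith

/-- **(0.9) for `M = fedM δ` on `SO(N)` for `δ ≤ 1/100`, `N·δ ≤ 3/4`**. [cite: Balaban1987RG1, (0.9) p.253] -/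
theorem fedM_mem_specialOrthogonal_of_chart (hU : ∀ j, U j ∈ (specialOrthogonalLogChart n).carrier)
    (hδ : δ ≤ 1 / 100) (hδN : (Fintype.card n : ℝ) * δ ≤ 3 / 4) :
    fedM δ U ∈ (specialOrthogonalLogChart n).carrier := by
  have hN : (0 : ℝ) < Fintype.card n := Nat.cast_pos.mpr Fintype.card_pos
  have hρ : 4 * δ ≤ (specialOrthogonalLogChart n).ρ := by
    rw [specialOrthogonalLogChart_ρ]
    refine le_min (le_min (by linarith) ?_) (by linarith)
    rw [le_div_iff₀ hN]
    linarith
  exact fedM_mem_logChart (specialOrthogonalLogChart n)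
    (fun _ hg => ⟨star_mem_SU hg.1, star_mem_realLogChart hg.2⟩) hU hδ hρ

omit [Nonempty n] in
/-- **(0.9) on the complexification `O(N, ℂ)`**: `(fedSol W)ᵀ fedSol W = 1` for complex-orthogonal families of
radius `δ ≤ 1/100` (print p. 253: `M` is «a Gᶜ-valued function»). [cite: Balaban1987RG1, (0.9) p.253] -/
theorem fedSol_mem_complexOrthogonal_of_chart {δ : ℝ} (hδ : δ ≤ 1 / 100) {W : ι → Matrix n n ℂ}
    (hWo : ∀ j, (W j).transpose * W j = 1) (hW : ∀ j, ‖W j - 1‖ ≤ δ) :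
    (fedSol W).transpose * fedSol W = 1 :=
  (mem_complexOrthogonalLogChart_carrier).1
    (fedSol_mem_logChart (complexOrthogonalLogChart n) hδ (by rw [complexOrthogonalLogChart_ρ]; linarith) hW hWo)

/-- **(0.9) on `SO(N, ℂ) = SO(N)ᶜ` for `N·δ ≤ 3/4`**: `(fedSol W)ᵀ fedSol W = 1` and `det (fedSol W) = 1`.
[cite: Balaban1987RG1, (0.9) p.253] -/
theorem fedSol_mem_specialComplexOrthogonal_of_chart {δ : ℝ} (hδ : δ ≤ 1 / 100)
    (hδN : (Fintype.card n : ℝ) * δ ≤ 3 / 4) {W : ι → Matrix n n ℂ}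
    (hWs : ∀ j, W j ∈ (specialComplexOrthogonalLogChart n).carrier) (hW : ∀ j, ‖W j - 1‖ ≤ δ) :
    fedSol W ∈ (specialComplexOrthogonalLogChart n).carrier := by
  refine fedSol_mem_logChart (specialComplexOrthogonalLogChart n) hδ ?_ hW hWs
  have hN : (0 : ℝ) < Fintype.card n := Nat.cast_pos.mpr Fintype.card_pos
  rw [specialComplexOrthogonalLogChart_ρ]
  refine le_min (by linarith) (le_min (by linarith) ?_)
  rw [le_div_iff₀ hN]
  linarith

omit [Nonempty n] in
/-- `O(N, ℂ)` is closed under `star`: `gᵀ g = 1 ⟹ g gᵀ = 1`, and `(g*)ᵀ g* = conj (g gᵀ) = 1` entrywise. [folklore] -/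
theorem star_mem_complexOrthogonalLogChart {g : Matrix n n ℂ} (hg : g ∈ (complexOrthogonalLogChart n).carrier) :
    star g ∈ (complexOrthogonalLogChart n).carrier := by
  rw [mem_complexOrthogonalLogChart_carrier] at hg ⊢
  have hg' : g * g.transpose = 1 := mul_eq_one_comm.1 hg
  have e1 : (star g).transpose = conjEntry n g := by
    ext i j; simp [conjEntry_apply, Matrix.map_apply, Matrix.star_apply, Matrix.transpose_apply]
  have e2 : star g = conjEntry n g.transpose := by
    ext i j; simp [conjEntry_apply, Matrix.map_apply, Matrix.star_apply, Matrix.transpose_apply]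
  rw [e1, e2, ← map_mul, hg', map_one]

omit [Nonempty n] in
/-- **(0.9) for the group average on `O(N, ℂ)`**: `fedM δ U ∈ O(N, ℂ)` for `O(N, ℂ)`-valued families, `δ ≤ 1/100`
(the complexified charts are `star`-closed, so §4b applies; I1 of `GAPS.md` C-pv11g13-1).
[cite: Balaban1987RG1, (0.9) p.253] -/
theorem fedM_mem_complexOrthogonal_of_chart (hU : ∀ j, U j ∈ (complexOrthogonalLogChart n).carrier)
    (hδ : δ ≤ 1 / 100) : fedM δ U ∈ (complexOrthogonalLogChart n).carrier :=
  fedM_mem_logChart (complexOrthogonalLogChart n) (fun _ hg => star_mem_complexOrthogonalLogChart hg) hU hδ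
    (by rw [complexOrthogonalLogChart_ρ]; linarith)

/-- `SL(N, ℂ)` is closed under `star`: `det g* = star (det g)`. [folklore] -/
theorem star_mem_specialLinearLogChart {g : Matrix n n ℂ} (hg : g ∈ (specialLinearLogChart n).carrier) :
    star g ∈ (specialLinearLogChart n).carrier := by
  rw [mem_specialLinearLogChart_carrier] at hg ⊢
  rw [Matrix.star_eq_conjTranspose, Matrix.det_conjTranspose, hg, star_one]

/-- **(0.9) for the group average on `SL(N, ℂ) = SU(N)ᶜ`**: `det (fedM δ U) = 1` for `SL(N, ℂ)`-valued families,
`δ ≤ 1/100`, `N·δ ≤ 3/4` (§4b on the `star`-closed chart `specialLinearLogChart`; I1 of `GAPS.md` C-pv11g13-1; the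
`fedSol` form is §5's `det_fedSol_eq_one_of_chart`). [cite: Balaban1987RG1, (0.9) p.253] -/
theorem det_fedM_eq_one_of_chart (hU : ∀ j, (U j).det = 1) (hδ : δ ≤ 1 / 100)
    (hδN : (Fintype.card n : ℝ) * δ ≤ 3 / 4) : (fedM δ U).det = 1 := by
  have hN : (0 : ℝ) < Fintype.card n := Nat.cast_pos.mpr Fintype.card_pos
  have hρ : 4 * δ ≤ (specialLinearLogChart n).ρ := by
    rw [specialLinearLogChart_ρ]
    refine le_min (by linarith) ?_
    rw [le_div_iff₀ hN]
    linarith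
  exact (mem_specialLinearLogChart_carrier).1 (fedM_mem_logChart (specialLinearLogChart n)
    (fun _ hg => star_mem_specialLinearLogChart hg) (fun j => (mem_specialLinearLogChart_carrier).2 (hU j)) hδ hρ)

/-- **(0.9) for the group average on `SO(N, ℂ) = SO(N)ᶜ`**: `fedM δ U ∈ SO(N, ℂ)` for `SO(N, ℂ)`-valued families,
`δ ≤ 1/100`, `N·δ ≤ 3/4`. [cite: Balaban1987RG1, (0.9) p.253] -/
theorem fedM_mem_specialComplexOrthogonal_of_chart
    (hU : ∀ j, U j ∈ (specialComplexOrthogonalLogChart n).carrier) (hδ : δ ≤ 1 / 100)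
    (hδN : (Fintype.card n : ℝ) * δ ≤ 3 / 4) : fedM δ U ∈ (specialComplexOrthogonalLogChart n).carrier := by
  have hN : (0 : ℝ) < Fintype.card n := Nat.cast_pos.mpr Fintype.card_pos
  have hρ : 4 * δ ≤ (specialComplexOrthogonalLogChart n).ρ := by
    rw [specialComplexOrthogonalLogChart_ρ]
    refine le_min (by linarith) (le_min (by linarith) ?_)
    rw [le_div_iff₀ hN]
    linarith
  exact fedM_mem_logChart (specialComplexOrthogonalLogChart n)
    (fun _ hg => ⟨star_mem_complexOrthogonalLogChart hg.1, star_mem_specialLinearLogChart hg.2⟩) hU hδ hρ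

/-! ### Non-vacuity -/

/-- `1 ∈ SO(N)` and the constant family at `1` meets every hypothesis of `fedM_mem_specialOrthogonal_of_chart` with
`δ = 0`. [folklore] -/
example : fedM 0 (fun _ : Fin (m + 1) => (1 : Matrix n n ℂ)) ∈ (specialOrthogonalLogChart n).carrier :=
  fedM_mem_specialOrthogonal_of_chart (fun _ => (specialOrthogonalLogChart n).one_mem) (by norm_num)
    (by rw [mul_zero]; norm_num)

end RealCorollaries

end FederbushMean

end Literature.MathematicalPhysics.QuantumFieldTheory.Balaban1983to89
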